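import Mathlib

/-!
# Smoothness of currying a family with jointly continuous jets into `P →ᵇ E`, `P` compact «(CURRY-∞)»

Topic `Analysis/Calculus`; namespace `Literature.Analysis.Calculus`.  THEOREMS ONLY (no `def`, no instance, no notation, no axiom, no named fact, no `sorry`); imports
Mathlib only.  Cell `pub/hodgecm-mathlib`, crux H413 (`stmt-HodgeConjecture-24833`), line LH3 (direct road `stub_N9`), letters L1 ∕ L3′ — the generic calculus brick of the
`z`-UNIFORM ∕ (α3) dress (LH3-plan (g3) word «(CURRY-∞)»; spec lock LH3-p01 (g4): `P` a COMPACT TOPOLOGICAL space, hypothesis in JET form; LH3-p04 (g4): circle head).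

THE MATHEMATICS.  `P` a compact topological space (no linear or smooth structure), `M`, `E` real normed spaces (no finite dimension, no completeness), `f : P × M → E`
with every `Y ↦ f (p, Y)` of class `C^n` and, for `m ≤ n`, the partial jet `(p, Y) ↦ D^m_Y f (p, Y)` JOINTLY continuous.  Then the curried map `g : M → (P →ᵇ E)`,
`g Y = (p ↦ f (p, Y))`, is `C^n` for the sup norm and its jets are the curried jets: `(D^m g (Y) v) (p) = D^m_Y f (p, Y) v`.
* §1 a continuous family `P → (M →L E)` ∕ `P → (M [×m]→L E)` ∕ `P → (M →L (M [×m]→L E))` curries to a continuous (multi)linear map into `P →ᵇ E` (∃-theorems; jets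
  are kept in `M [×m]→L[ℝ] (P →ᵇ E)`, never in `P →ᵇ (M [×m]→L E)`); the quantitative tube lemma over the compact `P × {X}`.
* §2 «(CU-1)» `hasFDerivAt_curry_of_forall_apply_eq` (+ jet-level twin): `HasFDerivAt (f (p, ·)) (f′ (p, Y)) Y` everywhere, `f′` jointly continuous ⇒ `HasFDerivAt g L X`,
  `L v p = f′ (p, X) v` — tube lemma, then Hörmander's mean-value inequality (1.1.2)″ against the FIXED map `T = f′ (p, X)` (the proof of his Thm. 1.1.6, uniformly in `p`).
* §3 jet formula by induction on the order with FIXED types, `ContDiff` via `contDiff_iff_continuous_differentiable`, `∞` form, `fderiv` ∕ `evalCLM` ∕ existence riders.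
* §4 jointly `C^n` source `Φ : Q × M → E` along a continuous `ι : P → Q` (partial jets = joint jets ∘ `inr`); §5 compact support; §6 the circle action
  `g X = (z ↦ f ((z : ℂ) • X))` on a complex normed space and on `Matrix (Fin 2) (Fin 2) ℂ` (`open scoped Matrix.Norms.Operator`) in LH3-p04's ∃-binder form.
Statements are in the characterised form `(hg : ∀ Y p, g Y p = f (p, Y))`: build `g` with any constructor, discharge `hg` by `rfl`.  Source for the Banach-space calculus
used (Def. 1.1.4, (1.1.2)″, Thms. 1.1.5–1.1.6, `C^k` jets Thm. 1.1.8): [cite: HormanderALPDO1, §1.1 pp. 7–12].  HONEST LABEL: HC_CM is proved only modulo the printed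
citations (2 remaining named inputs: hLiu418 = `stmt-HodgeConjecture-24832`, h413 = `stmt-HodgeConjecture-24833`) until rung 0 closes; count-neutral.

## References
* [HormanderALPDO1] L. Hörmander, *The Analysis of Linear Partial Differential Operators I*, Grundlehren 256, Springer (1983; 2nd ed. 1990), §1.1, Def. 1.1.4 (p. 7),
  (1.1.2)″ and Thms. 1.1.5–1.1.6 (p. 8), Thm. 1.1.8 (p. 11), Thm. 1.1.9 (p. 12).
-/

set_option autoImplicit false

noncomputable section

open Set Filter Topology Function Metric BoundedContinuousFunction
open scoped ContDiff NNReal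

namespace Literature.Analysis.Calculus

variable {P : Type*} [TopologicalSpace P] [CompactSpace P]
variable {M : Type*} [NormedAddCommGroup M] [NormedSpace ℝ M]
variable {E : Type*} [NormedAddCommGroup E] [NormedSpace ℝ E]

/-! ## §1 Curried continuous families as continuous (multi)linear maps into `P →ᵇ E` (existence only, no `def`) -/

section Flip

omit [NormedSpace ℝ M] in
/-- **Tube lemma, quantitative form**: a jointly continuous `φ : P × M → F` is uniformly-in-`p` continuous in the second variable at every `X`.
[cite: HormanderALPDO1, §1.1 Thm. 1.1.6 (p. 8)] -/
theorem eventually_forall_norm_sub_le_of_continuous {F : Type*} [SeminormedAddCommGroup F] {φ : P × M → F} (hφ : Continuous φ) (X : M)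
    {ε : ℝ} (hε : 0 < ε) : ∀ᶠ Y in 𝓝 X, ∀ p, ‖φ (p, Y) - φ (p, X)‖ ≤ ε := by
  have h : ∀ᶠ Y in 𝓝 X, ∀ p ∈ (univ : Set P), ‖φ (p, Y) - φ (p, X)‖ ≤ ε := by
    refine isCompact_univ.eventually_forall_of_forall_eventually fun p _ => ?_
    have hcont : Continuous fun z : M × P => φ (z.2, z.1) - φ (z.2, X) :=
      (hφ.comp (continuous_snd.prodMk continuous_fst)).sub (hφ.comp (continuous_snd.prodMk continuous_const))
    have ht : Tendsto (fun z : M × P => φ (z.2, z.1) - φ (z.2, X)) (𝓝 (X, p)) (𝓝 0) := by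
      simpa using hcont.tendsto (X, p)
    refine ((Metric.tendsto_nhds.1 ht) ε hε).mono fun z hz => ?_
    rw [dist_zero_right] at hz
    exact hz.le
  exact h.mono fun Y hY p => hY p (mem_univ p)

/-- A continuous family `ψ : P → (M →L[ℝ] E)` curries to a continuous linear `L : M →L[ℝ] (P →ᵇ E)`, `L w p = ψ p w`. [cite: HormanderALPDO1, §1.1 (1.1.2)″ (p. 8)] -/
theorem exists_clm_curry_of_continuous (ψ : P → (M →L[ℝ] E)) (hψ : Continuous ψ) :
    ∃ L : M →L[ℝ] (P →ᵇ E), ∀ (w : M) (p : P), L w p = ψ p w := by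
  obtain ⟨C, hC⟩ := isCompact_univ.exists_bound_of_continuousOn (f := ψ) hψ.continuousOn
  let L₀ : M →ₗ[ℝ] (P →ᵇ E) :=
    { toFun := fun w => BoundedContinuousFunction.mkOfCompact ⟨fun p => ψ p w, hψ.clm_apply continuous_const⟩
      map_add' := fun w w' => by ext p; simp
      map_smul' := fun c w => by ext p; simp }
  refine ⟨L₀.mkContinuous (max C 0) fun w => ?_, fun w p => rfl⟩
  refine (BoundedContinuousFunction.norm_le (by positivity)).mpr fun p => ?_
  change ‖ψ p w‖ ≤ max C 0 * ‖w‖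
  exact ((ψ p).le_opNorm w).trans (mul_le_mul_of_nonneg_right ((hC p (mem_univ p)).trans (le_max_left _ _)) (norm_nonneg _))

/-- A continuous family `ψ : P → (M [×m]→L[ℝ] E)` curries to a continuous multilinear `T : M [×m]→L[ℝ] (P →ᵇ E)`, `T v p = ψ p v`.
[cite: HormanderALPDO1, §1.1 (1.1.2)″ (p. 8)] -/
theorem exists_continuousMultilinearMap_curry_of_continuous {m : ℕ} (ψ : P → (M [×m]→L[ℝ] E)) (hψ : Continuous ψ) :
    ∃ T : M [×m]→L[ℝ] (P →ᵇ E), ∀ (v : Fin m → M) (p : P), T v p = ψ p v := by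
  classical
  obtain ⟨C, hC⟩ := isCompact_univ.exists_bound_of_continuousOn (f := ψ) hψ.continuousOn
  let T₀ : MultilinearMap ℝ (fun _ : Fin m => M) (P →ᵇ E) :=
    { toFun := fun v => BoundedContinuousFunction.mkOfCompact
        ⟨fun p => ψ p v, Continuous.comp (g := fun T : M [×m]→L[ℝ] E => T v) (continuous_eval_const v) hψ⟩
      map_update_add' := fun v i x y => by ext p; simp
      map_update_smul' := fun v i c x => by ext p; simp }
  refine ⟨T₀.mkContinuous (max C 0) fun v => ?_, fun v p => rfl⟩
  refine (BoundedContinuousFunction.norm_le (by positivity)).mpr fun p => ?_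
  change ‖ψ p v‖ ≤ max C 0 * ∏ i, ‖v i‖
  exact ((ψ p).le_opNorm v).trans (mul_le_mul_of_nonneg_right ((hC p (mem_univ p)).trans (le_max_left _ _)) (by positivity))

/-- A continuous family `ψ : P → (M →L[ℝ] (M [×m]→L[ℝ] E))` curries to a continuous linear `D : M →L[ℝ] (M [×m]→L[ℝ] (P →ᵇ E))`, `D w v p = ψ p w v` (the shape of the
derivative of an `m`-th jet of the curried map). [cite: HormanderALPDO1, §1.1 (1.1.2)″ (p. 8)] -/
theorem exists_clm_continuousMultilinearMap_curry_of_continuous {m : ℕ} (ψ : P → (M →L[ℝ] (M [×m]→L[ℝ] E))) (hψ : Continuous ψ) :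
    ∃ D : M →L[ℝ] (M [×m]→L[ℝ] (P →ᵇ E)), ∀ (w : M) (v : Fin m → M) (p : P), D w v p = ψ p w v := by
  obtain ⟨C, hC⟩ := isCompact_univ.exists_bound_of_continuousOn (f := ψ) hψ.continuousOn
  have key : ∀ w : M, ∃ T : M [×m]→L[ℝ] (P →ᵇ E), (∀ v p, T v p = ψ p w v) ∧ ‖T‖ ≤ max C 0 * ‖w‖ := by
    intro w
    obtain ⟨T, hT⟩ := exists_continuousMultilinearMap_curry_of_continuous (E := E) (fun p => ψ p w) (hψ.clm_apply continuous_const)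
    refine ⟨T, hT, ContinuousMultilinearMap.opNorm_le_bound (by positivity) fun v => ?_⟩
    refine (BoundedContinuousFunction.norm_le (by positivity)).mpr fun p => ?_
    rw [hT]
    calc ‖ψ p w v‖ ≤ ‖ψ p w‖ * ∏ i, ‖v i‖ := (ψ p w).le_opNorm v
      _ ≤ (‖ψ p‖ * ‖w‖) * ∏ i, ‖v i‖ := by gcongr; exact (ψ p).le_opNorm w
      _ ≤ (max C 0 * ‖w‖) * ∏ i, ‖v i‖ := by gcongr; exact (hC p (mem_univ p)).trans (le_max_left _ _)
  choose T hT hTn using key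
  let D₀ : M →ₗ[ℝ] (M [×m]→L[ℝ] (P →ᵇ E)) :=
    { toFun := T
      map_add' := fun w w' => by ext v p; simp [hT]
      map_smul' := fun c w => by ext v p; simp [hT] }
  exact ⟨D₀.mkContinuous (max C 0) fun w => hTn w, fun w v p => hT w v p⟩

end Flip

/-! ## §2 Continuity and the first-order engine (CU-1), at level `0` (`P →ᵇ E`) and at jet level `m` (`M [×m]→L[ℝ] (P →ᵇ E)`) -/

section FirstOrder

omit [NormedSpace ℝ M] [NormedSpace ℝ E] in
/-- **Continuity of the curried map** into `P →ᵇ E` (uniform topology) from joint continuity — the tube lemma. [cite: HormanderALPDO1, §1.1 Thm. 1.1.6 (p. 8)] -/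
theorem continuous_curry_of_forall_apply_eq {f : P × M → E} {g : M → (P →ᵇ E)} (hg : ∀ Y p, g Y p = f (p, Y)) (hf : Continuous f) :
    Continuous g := by
  let φ : C(M × P, E) := ⟨fun q => f (q.2, q.1), hf.comp (continuous_snd.prodMk continuous_fst)⟩
  have heq : g = fun Y => ContinuousMap.equivBoundedOfCompact P E (φ.curry Y) := by
    funext Y; ext p; rw [hg]; rfl
  rw [heq]
  exact (ContinuousMap.isometryEquivBoundedOfCompact P E).continuous.comp φ.curry.continuous

/-- **Continuity at jet level**: `G : M → (M [×m]→L[ℝ] (P →ᵇ E))` with `G Y v p = φ (p, Y) v` and `φ` jointly continuous is continuous (sup-`opNorm` estimate + tube lemma).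
[cite: HormanderALPDO1, §1.1 Thm. 1.1.6 (p. 8)] -/
theorem continuous_multilinear_curry_of_forall_apply_eq {m : ℕ} {φ : P × M → (M [×m]→L[ℝ] E)} {G : M → (M [×m]→L[ℝ] (P →ᵇ E))}
    (hG : ∀ Y v p, G Y v p = φ (p, Y) v) (hφ : Continuous φ) : Continuous G := by
  refine continuous_iff_continuousAt.2 fun X => ?_
  rw [ContinuousAt, Metric.tendsto_nhds]
  intro ε hε
  refine (eventually_forall_norm_sub_le_of_continuous (φ := φ) hφ X (half_pos hε)).mono fun Y hY => ?_
  rw [dist_eq_norm]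
  refine lt_of_le_of_lt (ContinuousMultilinearMap.opNorm_le_bound (by positivity) fun v => ?_) (half_lt_self hε)
  refine (BoundedContinuousFunction.norm_le (by positivity)).mpr fun p => ?_
  have hrew : (G Y - G X) v p = (φ (p, Y) - φ (p, X)) v := by
    simp only [_root_.sub_apply, BoundedContinuousFunction.sub_apply, hG]
  rw [hrew]
  exact ((φ (p, Y) - φ (p, X)).le_opNorm v).trans (mul_le_mul_of_nonneg_right (hY p) (by positivity))

/-- **(CU-1) the first-order engine.** `HasFDerivAt (f (p, ·)) (f′ (p, Y)) Y` everywhere with `f′` JOINTLY continuous ⇒ the curried map `g` (`g Y p = f (p, Y)`) has at `X`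
the derivative `L`, `L v p = f′ (p, X) v`, into `P →ᵇ E` (tube lemma + mean-value inequality against the fixed map `f′ (p, X)`). [cite: HormanderALPDO1, §1.1 (1.1.2)″ and Thm. 1.1.6 (p. 8)] -/
theorem hasFDerivAt_curry_of_forall_apply_eq {f : P × M → E} {f' : P × M → (M →L[ℝ] E)} {g : M → (P →ᵇ E)}
    (hg : ∀ Y p, g Y p = f (p, Y)) (hf : ∀ p Y, HasFDerivAt (fun Y => f (p, Y)) (f' (p, Y)) Y) (hc' : Continuous f')
    {X : M} {L : M →L[ℝ] (P →ᵇ E)} (hL : ∀ v p, L v p = f' (p, X) v) :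
    HasFDerivAt g L X := by
  rw [hasFDerivAt_iff_isLittleO_nhds_zero, Asymptotics.isLittleO_iff]
  intro ε hε
  obtain ⟨δ, hδ, hball⟩ := Metric.eventually_nhds_iff_ball.1 (eventually_forall_norm_sub_le_of_continuous (φ := f') hc' X hε)
  refine Filter.mem_of_superset (Metric.ball_mem_nhds (0 : M) hδ) fun h hh => ?_
  have hXh : X + h ∈ ball X δ := by
    rw [mem_ball_iff_norm, add_sub_cancel_left]; rwa [mem_ball_zero_iff] at hh
  change ‖g (X + h) - g X - L h‖ ≤ ε * ‖h‖
  refine (BoundedContinuousFunction.norm_le (by positivity)).mpr fun p => ?_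
  have hrew : (g (X + h) - g X - L h) p = f (p, X + h) - f (p, X) - f' (p, X) ((X + h) - X) := by
    simp only [BoundedContinuousFunction.coe_sub, Pi.sub_apply, hg, hL, add_sub_cancel_left]
  rw [hrew]
  have hmvt := (convex_ball X δ).norm_image_sub_le_of_norm_hasFDerivWithin_le'
    (f := fun Y => f (p, Y)) (f' := fun Y => f' (p, Y)) (φ := f' (p, X)) (C := ε)
    (fun Y _ => (hf p Y).hasFDerivWithinAt) (fun Y hY => hball Y hY p) (mem_ball_self hδ) hXh
  simpa only [add_sub_cancel_left] using hmvt

/-- **(CU-1) at jet level `m`**: `G Y v p = φ (p, Y) v`, `HasFDerivAt (φ (p, ·)) (φ′ (p, Y)) Y` everywhere, `φ′` jointly continuous ⇒ `HasFDerivAt G D X` whenever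
`D w v p = φ′ (p, X) w v` (same mechanism, one `opNorm` layer more). [cite: HormanderALPDO1, §1.1 (1.1.2)″ (p. 8)] -/
theorem hasFDerivAt_multilinear_curry_of_forall_apply_eq {m : ℕ} {φ : P × M → (M [×m]→L[ℝ] E)} {φ' : P × M → (M →L[ℝ] (M [×m]→L[ℝ] E))}
    {G : M → (M [×m]→L[ℝ] (P →ᵇ E))} (hG : ∀ Y v p, G Y v p = φ (p, Y) v)
    (hφ : ∀ p Y, HasFDerivAt (fun Y => φ (p, Y)) (φ' (p, Y)) Y) (hc' : Continuous φ')
    {X : M} {D : M →L[ℝ] (M [×m]→L[ℝ] (P →ᵇ E))} (hD : ∀ w v p, D w v p = φ' (p, X) w v) :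
    HasFDerivAt G D X := by
  rw [hasFDerivAt_iff_isLittleO_nhds_zero, Asymptotics.isLittleO_iff]
  intro ε hε
  obtain ⟨δ, hδ, hball⟩ := Metric.eventually_nhds_iff_ball.1 (eventually_forall_norm_sub_le_of_continuous (φ := φ') hc' X hε)
  refine Filter.mem_of_superset (Metric.ball_mem_nhds (0 : M) hδ) fun h hh => ?_
  have hXh : X + h ∈ ball X δ := by
    rw [mem_ball_iff_norm, add_sub_cancel_left]; rwa [mem_ball_zero_iff] at hh
  change ‖G (X + h) - G X - D h‖ ≤ ε * ‖h‖
  refine ContinuousMultilinearMap.opNorm_le_bound (by positivity) fun v => ?_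
  refine (BoundedContinuousFunction.norm_le (by positivity)).mpr fun p => ?_
  have hrew : (G (X + h) - G X - D h) v p = (φ (p, X + h) - φ (p, X) - φ' (p, X) h) v := by
    simp only [_root_.sub_apply, BoundedContinuousFunction.sub_apply, hG, hD]
  rw [hrew]
  have hmvt := (convex_ball X δ).norm_image_sub_le_of_norm_hasFDerivWithin_le'
    (f := fun Y => φ (p, Y)) (f' := fun Y => φ' (p, Y)) (φ := φ' (p, X)) (C := ε)
    (fun Y _ => (hφ p Y).hasFDerivWithinAt) (fun Y hY => hball Y hY p) (mem_ball_self hδ) hXh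
  rw [add_sub_cancel_left] at hmvt
  exact ((φ (p, X + h) - φ (p, X) - φ' (p, X) h).le_opNorm v).trans (mul_le_mul_of_nonneg_right hmvt (by positivity))

/-- The derivative map of (CU-1) exists: some `L : M →L[ℝ] (P →ᵇ E)` with `L v p = f′ (p, X) v`. [cite: HormanderALPDO1, §1.1 (1.1.2)″ (p. 8)] -/
theorem exists_clm_forall_apply_eq {f' : P × M → (M →L[ℝ] E)} (hc' : Continuous f') (X : M) :
    ∃ L : M →L[ℝ] (P →ᵇ E), ∀ v p, L v p = f' (p, X) v :=
  exists_clm_curry_of_continuous (fun p => f' (p, X)) (hc'.comp (continuous_id.prodMk continuous_const))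

/-- (CU-1), `fderiv` form: `g` is differentiable at `X` with `fderiv ℝ g X v p = f′ (p, X) v`. [cite: HormanderALPDO1, §1.1 (1.1.2)″ (p. 8)] -/
theorem fderiv_curry_apply_of_hasFDerivAt {f : P × M → E} {f' : P × M → (M →L[ℝ] E)} {g : M → (P →ᵇ E)}
    (hg : ∀ Y p, g Y p = f (p, Y)) (hf : ∀ p Y, HasFDerivAt (fun Y => f (p, Y)) (f' (p, Y)) Y) (hc' : Continuous f')
    (X v : M) (p : P) :
    DifferentiableAt ℝ g X ∧ fderiv ℝ g X v p = f' (p, X) v := by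
  obtain ⟨L, hL⟩ := exists_clm_forall_apply_eq (E := E) hc' X
  have h := hasFDerivAt_curry_of_forall_apply_eq hg hf hc' hL
  exact ⟨h.differentiableAt, by rw [h.fderiv, hL]⟩

end FirstOrder

/-! ## §3 All orders: the jet formula and `ContDiff` -/

section AllOrders

variable {n : ℕ∞} {f : P × M → E} {g : M → (P →ᵇ E)}

omit [CompactSpace P] in
/-- Continuity of `(p, Y) ↦ fderiv (D^m_Y f (p, ·)) Y` from the next jointly continuous partial jet (curry-left reading). [cite: HormanderALPDO1, §1.1 (1.1.2)″ (p. 8)] -/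
theorem continuous_fderiv_iteratedFDeriv_curry {m : ℕ}
    (hc : Continuous (fun q : P × M => iteratedFDeriv ℝ (m + 1) (fun Y => f (q.1, Y)) q.2)) :
    Continuous (fun q : P × M => fderiv ℝ (iteratedFDeriv ℝ m (fun Y => f (q.1, Y))) q.2) := by
  have heq : (fun q : P × M => fderiv ℝ (iteratedFDeriv ℝ m (fun Y => f (q.1, Y))) q.2) =
      fun q => (continuousMultilinearCurryLeftEquiv ℝ (fun _ : Fin (m + 1) => M) E) (iteratedFDeriv ℝ (m + 1) (fun Y => f (q.1, Y)) q.2) := by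
    funext q; rw [fderiv_iteratedFDeriv]; rfl
  rw [heq]
  exact (continuousMultilinearCurryLeftEquiv ℝ (fun _ : Fin (m + 1) => M) E).continuous.comp hc

/-- **Differentiability step**: if `D^m g` is the curried `m`-th partial jet, `m < n` and the `(m+1)`-st partial jet is jointly continuous, then `D^m g` has at `Y` a
derivative `D`, `D w v p = fderiv (D^m f (p, ·)) Y w v`. [cite: HormanderALPDO1, §1.1 Thm. 1.1.6 (p. 8)] -/
theorem exists_hasFDerivAt_iteratedFDeriv_curry {m : ℕ} (hjet : ∀ Y v p, iteratedFDeriv ℝ m g Y v p = iteratedFDeriv ℝ m (fun Y => f (p, Y)) Y v)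
    (hf : ∀ p, ContDiff ℝ n (fun Y => f (p, Y))) (hlt : (m : ℕ∞) < n)
    (hc : Continuous (fun q : P × M => iteratedFDeriv ℝ (m + 1) (fun Y => f (q.1, Y)) q.2)) (Y : M) :
    ∃ D : M →L[ℝ] (M [×m]→L[ℝ] (P →ᵇ E)), HasFDerivAt (iteratedFDeriv ℝ m g) D Y ∧
      ∀ w v p, D w v p = (fderiv ℝ (iteratedFDeriv ℝ m (fun Y => f (p, Y))) Y) w v := by
  have hfm' := continuous_fderiv_iteratedFDeriv_curry hc
  obtain ⟨D, hD⟩ := exists_clm_continuousMultilinearMap_curry_of_continuous (E := E)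
    (fun p => fderiv ℝ (iteratedFDeriv ℝ m (fun Y => f (p, Y))) Y) (hfm'.comp (continuous_id.prodMk continuous_const))
  refine ⟨D, hasFDerivAt_multilinear_curry_of_forall_apply_eq (φ := fun q : P × M => iteratedFDeriv ℝ m (fun Y => f (q.1, Y)) q.2)
    (φ' := fun q : P × M => fderiv ℝ (iteratedFDeriv ℝ m (fun Y => f (q.1, Y))) q.2) hjet
    (fun p' Y' => (((hf p').differentiable_iteratedFDeriv (by exact_mod_cast hlt)) Y').hasFDerivAt) hfm' hD, hD⟩

/-- **The jet formula**: pointwise `C^n` + jointly continuous partial jets up to order `n` ⇒ for `m ≤ n`, `iteratedFDeriv ℝ m g Y v p = iteratedFDeriv ℝ m (f (p, ·)) Y v`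
(induction on `m` with fixed types, (CU-1) at jet level `m`). [cite: HormanderALPDO1, §1.1 Thms. 1.1.6, 1.1.8 (pp. 8–11)] -/
theorem iteratedFDeriv_curry_apply_of_forall_apply_eq (hg : ∀ Y p, g Y p = f (p, Y)) (hf : ∀ p, ContDiff ℝ n (fun Y => f (p, Y)))
    (hc : ∀ m : ℕ, (m : ℕ∞) ≤ n → Continuous (fun q : P × M => iteratedFDeriv ℝ m (fun Y => f (q.1, Y)) q.2))
    {m : ℕ} (hm : (m : ℕ∞) ≤ n) (Y : M) (v : Fin m → M) (p : P) :
    iteratedFDeriv ℝ m g Y v p = iteratedFDeriv ℝ m (fun Y => f (p, Y)) Y v := by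
  induction m generalizing Y p with
  | zero => simp [iteratedFDeriv_zero_apply, hg]
  | succ m ih =>
    have hm' : (m : ℕ∞) ≤ n := le_trans (by exact_mod_cast m.le_succ) hm
    have hlt : (m : ℕ∞) < n := lt_of_lt_of_le (by exact_mod_cast Nat.lt_succ_self m) hm
    obtain ⟨D, hD, hDapply⟩ := exists_hasFDerivAt_iteratedFDeriv_curry (fun Y v p => ih hm' Y v p) hf hlt (hc (m + 1) hm) Y
    rw [iteratedFDeriv_succ_apply_left, iteratedFDeriv_succ_apply_left, hD.fderiv, hDapply]

/-- **(CURRY-∞), general order**: `P` compact topological, `M`, `E` real normed, every `Y ↦ f (p, Y)` of class `C^n`, partial jets `(p, Y) ↦ D^m_Y f (p, Y)` jointly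
continuous for `m ≤ n` ⇒ the curried map `g : M → (P →ᵇ E)` (`g Y p = f (p, Y)`) is `C^n`. [cite: HormanderALPDO1, §1.1 Thms. 1.1.6, 1.1.8 (pp. 8–11)] -/
theorem contDiff_curry_of_forall_apply_eq (hg : ∀ Y p, g Y p = f (p, Y)) (hf : ∀ p, ContDiff ℝ n (fun Y => f (p, Y)))
    (hc : ∀ m : ℕ, (m : ℕ∞) ≤ n → Continuous (fun q : P × M => iteratedFDeriv ℝ m (fun Y => f (q.1, Y)) q.2)) :
    ContDiff ℝ n g := by
  refine contDiff_iff_continuous_differentiable.2 ⟨fun m hm => ?_, fun m hm => ?_⟩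
  · have hm' : (m : ℕ∞) ≤ n := by exact_mod_cast hm
    exact continuous_multilinear_curry_of_forall_apply_eq (φ := fun q : P × M => iteratedFDeriv ℝ m (fun Y => f (q.1, Y)) q.2)
      (fun Y v p => iteratedFDeriv_curry_apply_of_forall_apply_eq hg hf hc hm' Y v p) (hc m hm')
  · have hmn : (m : ℕ∞) < n := by exact_mod_cast hm
    have hm1 : ((m + 1 : ℕ) : ℕ∞) ≤ n := by push_cast; exact Order.add_one_le_of_lt hmn
    intro Y
    obtain ⟨D, hD, -⟩ := exists_hasFDerivAt_iteratedFDeriv_curry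
      (fun Y v p => iteratedFDeriv_curry_apply_of_forall_apply_eq hg hf hc hmn.le Y v p) hf hmn (hc (m + 1) hm1) Y
    exact hD.differentiableAt

/-- **(CURRY-∞), `C^∞` form in the consumer's hypothesis shape** (LH3-p01 (g4)): all partial jets jointly continuous and every `Y ↦ f (p, Y)` smooth ⇒ `g` is smooth
into `P →ᵇ E`. [cite: HormanderALPDO1, §1.1 Thms. 1.1.6, 1.1.8 (pp. 8–11)] -/
theorem contDiff_curry_infty_of_forall_apply_eq (hg : ∀ Y p, g Y p = f (p, Y)) (hf : ∀ p, ContDiff ℝ ∞ (fun Y => f (p, Y)))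
    (hc : ∀ m : ℕ, Continuous (fun q : P × M => iteratedFDeriv ℝ m (fun Y => f (q.1, Y)) q.2)) :
    ContDiff ℝ ∞ g :=
  contDiff_curry_of_forall_apply_eq hg hf fun m _ => hc m

/-- The jet formula in the `C^∞` hypothesis shape. [cite: HormanderALPDO1, §1.1 Thms. 1.1.6, 1.1.8 (pp. 8–11)] -/
theorem iteratedFDeriv_curry_apply_infty_of_forall_apply_eq (hg : ∀ Y p, g Y p = f (p, Y)) (hf : ∀ p, ContDiff ℝ ∞ (fun Y => f (p, Y)))
    (hc : ∀ m : ℕ, Continuous (fun q : P × M => iteratedFDeriv ℝ m (fun Y => f (q.1, Y)) q.2)) (m : ℕ) (Y : M) (v : Fin m → M) (p : P) :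
    iteratedFDeriv ℝ m g Y v p = iteratedFDeriv ℝ m (fun Y => f (p, Y)) Y v :=
  iteratedFDeriv_curry_apply_of_forall_apply_eq (n := (⊤ : ℕ∞)) hg hf (fun m _ => hc m) le_top Y v p

/-- **Evaluation commutes with the jets**: `evalCLM p ∘ D^m g (Y) = D^m (f (p, ·)) (Y)`. [cite: HormanderALPDO1, §1.1 Thm. 1.1.6 (p. 8)] -/
theorem evalCLM_compContinuousMultilinearMap_iteratedFDeriv_curry (hg : ∀ Y p, g Y p = f (p, Y)) (hf : ∀ p, ContDiff ℝ n (fun Y => f (p, Y)))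
    (hc : ∀ m : ℕ, (m : ℕ∞) ≤ n → Continuous (fun q : P × M => iteratedFDeriv ℝ m (fun Y => f (q.1, Y)) q.2))
    {m : ℕ} (hm : (m : ℕ∞) ≤ n) (Y : M) (p : P) :
    (BoundedContinuousFunction.evalCLM ℝ p).compContinuousMultilinearMap (iteratedFDeriv ℝ m g Y) = iteratedFDeriv ℝ m (fun Y => f (p, Y)) Y := by
  ext v
  rw [ContinuousLinearMap.compContinuousMultilinearMap_coe, Function.comp_apply, BoundedContinuousFunction.evalCLM_apply]
  exact iteratedFDeriv_curry_apply_of_forall_apply_eq hg hf hc hm Y v p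

/-- **First derivative of the curried map** (`1 ≤ n`): `fderiv ℝ g Y v p = fderiv ℝ (f (p, ·)) Y v`. [cite: HormanderALPDO1, §1.1 (1.1.2)″ (p. 8)] -/
theorem fderiv_curry_apply_of_forall_apply_eq (hg : ∀ Y p, g Y p = f (p, Y)) (hf : ∀ p, ContDiff ℝ n (fun Y => f (p, Y)))
    (hc : ∀ m : ℕ, (m : ℕ∞) ≤ n → Continuous (fun q : P × M => iteratedFDeriv ℝ m (fun Y => f (q.1, Y)) q.2))
    (hn : 1 ≤ n) (Y v : M) (p : P) :
    fderiv ℝ g Y v p = fderiv ℝ (fun Y => f (p, Y)) Y v := by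
  have h := iteratedFDeriv_curry_apply_of_forall_apply_eq hg hf hc (m := 1) (by exact_mod_cast hn) Y ![v] p
  simpa only [iteratedFDeriv_one_apply, Matrix.cons_val_zero] using h

/-- **Existence form**: there is a `C^n` map `g : M → (P →ᵇ E)` with `g Y p = f (p, Y)`. [cite: HormanderALPDO1, §1.1 Thms. 1.1.6, 1.1.8 (pp. 8–11)] -/
theorem exists_contDiff_curry (hf : ∀ p, ContDiff ℝ n (fun Y => f (p, Y)))
    (hc : ∀ m : ℕ, (m : ℕ∞) ≤ n → Continuous (fun q : P × M => iteratedFDeriv ℝ m (fun Y => f (q.1, Y)) q.2)) :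
    ∃ g : M → (P →ᵇ E), (∀ Y p, g Y p = f (p, Y)) ∧ ContDiff ℝ n g := by
  have h0 : Continuous f := by
    have heq : f = fun q : P × M => (iteratedFDeriv ℝ 0 (fun Y => f (q.1, Y)) q.2) (fun _ => 0) := by
      funext q; rw [iteratedFDeriv_zero_apply]
    rw [heq]
    exact (continuous_eval_const (fun _ : Fin 0 => (0 : M))).comp (hc 0 (by exact_mod_cast bot_le))
  exact ⟨fun Y => BoundedContinuousFunction.mkOfCompact ⟨fun p => f (p, Y), h0.comp (continuous_id.prodMk continuous_const)⟩, fun Y p => rfl,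
    contDiff_curry_of_forall_apply_eq (fun Y p => rfl) hf hc⟩

end AllOrders

/-! ## §4 Jointly smooth source on a normed parameter space, restricted along a continuous map from `P` -/

section Joint

variable {Q : Type*} [NormedAddCommGroup Q] [NormedSpace ℝ Q] {n : ℕ∞}

omit [CompactSpace P] in
/-- Partial jets of a jointly `C^n` map are the joint jets composed with `inr` in every slot. [cite: HormanderALPDO1, §1.1 (1.1.2)″ (p. 8)] -/
theorem iteratedFDeriv_curry_right_eq_compContinuousLinearMap {Φ : Q × M → E} (hΦ : ContDiff ℝ n Φ) (q : Q) (Y : M) {m : ℕ} (hm : (m : ℕ∞) ≤ n) :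
    iteratedFDeriv ℝ m (fun Y => Φ (q, Y)) Y = (iteratedFDeriv ℝ m Φ (q, Y)).compContinuousLinearMap fun _ => ContinuousLinearMap.inr ℝ Q M := by
  have h1 : (fun Y : M => Φ (q, Y)) = (fun z : Q × M => Φ ((q, 0) + z)) ∘ (ContinuousLinearMap.inr ℝ Q M) := by
    funext Y; simp
  have hΦ' : ContDiff ℝ n (fun z : Q × M => Φ ((q, 0) + z)) := hΦ.comp (contDiff_const.add contDiff_id)
  rw [h1, ContinuousLinearMap.iteratedFDeriv_comp_right _ hΦ' _ (by exact_mod_cast hm), iteratedFDeriv_comp_add_left]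
  simp

omit [CompactSpace P] in
/-- Joint continuity of the partial jets of a jointly `C^n` map along a continuous `ι : P → Q`. [cite: HormanderALPDO1, §1.1 (1.1.2)″ (p. 8)] -/
theorem continuous_iteratedFDeriv_curry_of_contDiff {Φ : Q × M → E} (hΦ : ContDiff ℝ n Φ) {ι : P → Q} (hι : Continuous ι) {m : ℕ} (hm : (m : ℕ∞) ≤ n) :
    Continuous (fun q : P × M => iteratedFDeriv ℝ m (fun Y => Φ (ι q.1, Y)) q.2) := by
  have heq : (fun q : P × M => iteratedFDeriv ℝ m (fun Y => Φ (ι q.1, Y)) q.2) =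
      fun q => (ContinuousMultilinearMap.compContinuousLinearMapL (F := E) fun _ : Fin m => ContinuousLinearMap.inr ℝ Q M)
        (iteratedFDeriv ℝ m Φ (ι q.1, q.2)) := by
    funext q
    rw [iteratedFDeriv_curry_right_eq_compContinuousLinearMap hΦ (ι q.1) q.2 hm, ContinuousMultilinearMap.compContinuousLinearMapL_apply]
  rw [heq]
  exact (ContinuousMultilinearMap.compContinuousLinearMapL (F := E) fun _ : Fin m => ContinuousLinearMap.inr ℝ Q M).continuous.comp
    ((hΦ.continuous_iteratedFDeriv (by exact_mod_cast hm)).comp ((hι.comp continuous_fst).prodMk continuous_snd))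

/-- **(CURRY-∞) for a jointly smooth family**: `Φ : Q × M → E` `C^n`, `ι : P → Q` continuous from a compact `P` (e.g. inclusion of a compact subset): `g Y p = Φ (ι p, Y)`
is `C^n` into `P →ᵇ E`. [cite: HormanderALPDO1, §1.1 Thms. 1.1.6, 1.1.8 (pp. 8–11)] -/
theorem contDiff_curry_of_contDiff {Φ : Q × M → E} (hΦ : ContDiff ℝ n Φ) {ι : P → Q} (hι : Continuous ι) {g : M → (P →ᵇ E)}
    (hg : ∀ Y p, g Y p = Φ (ι p, Y)) : ContDiff ℝ n g :=
  contDiff_curry_of_forall_apply_eq (f := fun q : P × M => Φ (ι q.1, q.2)) hg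
    (fun p => show ContDiff ℝ n (fun Y => Φ (ι p, Y)) from hΦ.comp (contDiff_const.prodMk contDiff_id))
    fun _ hm => continuous_iteratedFDeriv_curry_of_contDiff hΦ hι hm

/-- Jet formula for a jointly smooth family. [cite: HormanderALPDO1, §1.1 Thms. 1.1.6, 1.1.8 (pp. 8–11)] -/
theorem iteratedFDeriv_curry_apply_of_contDiff {Φ : Q × M → E} (hΦ : ContDiff ℝ n Φ) {ι : P → Q} (hι : Continuous ι) {g : M → (P →ᵇ E)}
    (hg : ∀ Y p, g Y p = Φ (ι p, Y)) {m : ℕ} (hm : (m : ℕ∞) ≤ n) (Y : M) (v : Fin m → M) (p : P) :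
    iteratedFDeriv ℝ m g Y v p = iteratedFDeriv ℝ m (fun Y => Φ (ι p, Y)) Y v :=
  iteratedFDeriv_curry_apply_of_forall_apply_eq (f := fun q : P × M => Φ (ι q.1, q.2)) hg
    (fun p => show ContDiff ℝ n (fun Y => Φ (ι p, Y)) from hΦ.comp (contDiff_const.prodMk contDiff_id))
    (fun _ hm => continuous_iteratedFDeriv_curry_of_contDiff hΦ hι hm) hm Y v p

end Joint

/-! ## §5 Compact support of the curried map -/

section Support

omit [CompactSpace P] [NormedSpace ℝ M] [NormedSpace ℝ E] in
/-- If all `f (p, ·)` vanish off ONE compact `C ⊆ M` the curried map has compact support. [cite: HormanderALPDO1, §1.1 Thms. 1.1.6, 1.1.8 (pp. 8–11)] -/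
theorem hasCompactSupport_curry_of_forall_apply_eq {f : P × M → E} {g : M → (P →ᵇ E)} (hg : ∀ Y p, g Y p = f (p, Y))
    {C : Set M} (hC : IsCompact C) (h0 : ∀ p, ∀ Y ∉ C, f (p, Y) = 0) : HasCompactSupport g := by
  refine HasCompactSupport.intro hC fun Y hY => ?_
  ext p
  rw [hg, h0 p Y hY]; rfl

end Support

/-! ## §6 The circle-action instance (LH3-p04 (g4)'s consumer form) -/

section CircleAction

variable {V : Type*} [NormedAddCommGroup V] [NormedSpace ℝ V] [NormedSpace ℂ V] [IsScalarTower ℝ ℂ V]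

/-- **Circle-curried `C_c^n` functions** on a complex normed space `V`: `∃ g : V → (Circle →ᵇ E)`, `C^n`, compactly supported, `g X z = f ((z : ℂ) • X)`, with the
curried jets (any `V`, e.g. `Matrix (Fin 2) (Fin 2) ℂ`). [cite: HormanderALPDO1, §1.1 Thms. 1.1.6, 1.1.8 (pp. 8–11)] -/
theorem exists_contDiff_curry_circle_smul_of_normedSpace {n : ℕ∞} {f : V → E} (hf : ContDiff ℝ n f) (hfc : HasCompactSupport f) :
    ∃ g : V → (Circle →ᵇ E), ContDiff ℝ n g ∧ HasCompactSupport g ∧ (∀ (X : V) (z : Circle), g X z = f ((z : ℂ) • X)) ∧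
      ∀ (m : ℕ), (m : ℕ∞) ≤ n → ∀ (X : V) (v : Fin m → V) (z : Circle), iteratedFDeriv ℝ m g X v z = iteratedFDeriv ℝ m (fun X => f ((z : ℂ) • X)) X v := by
  have hΦ : ContDiff ℝ n (fun q : ℂ × V => f (q.1 • q.2)) := hf.comp (contDiff_fst.smul contDiff_snd)
  have hι : Continuous (fun z : Circle => (z : ℂ)) := continuous_subtype_val
  have h0 : Continuous (fun q : Circle × V => f ((q.1 : ℂ) • q.2)) := hf.continuous.comp ((hι.comp continuous_fst).smul continuous_snd)
  let g : V → (Circle →ᵇ E) := fun X => BoundedContinuousFunction.mkOfCompact ⟨fun z => f ((z : ℂ) • X), h0.comp (continuous_id.prodMk continuous_const)⟩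
  have hg : ∀ X z, g X z = (fun q : ℂ × V => f (q.1 • q.2)) ((fun z : Circle => (z : ℂ)) z, X) := fun X z => rfl
  refine ⟨g, contDiff_curry_of_contDiff hΦ hι hg, ?_, fun X z => rfl, fun m hm X v z => iteratedFDeriv_curry_apply_of_contDiff hΦ hι hg hm X v z⟩
  have hCc : IsCompact ((fun q : Circle × V => ((q.1 : ℂ)⁻¹) • q.2) '' (univ ×ˢ tsupport f)) :=
    (isCompact_univ.prod hfc).image (((hι.comp continuous_fst).inv₀ fun q => q.1.coe_ne_zero).smul continuous_snd)
  refine hasCompactSupport_curry_of_forall_apply_eq (f := fun q : Circle × V => f ((q.1 : ℂ) • q.2)) (fun X z => rfl) hCc fun z X hX => ?_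
  apply image_eq_zero_of_notMem_tsupport
  intro hmem
  exact hX ⟨(z, (z : ℂ) • X), ⟨mem_univ _, hmem⟩, by simp [inv_smul_smul₀ z.coe_ne_zero]⟩

open scoped Matrix.Norms.Operator in
/-- **LH3-p04 (g4)'s consumer head, verbatim binder form**: for `f ∈ C_c^∞(M₂(ℂ), E)` (operator sup norm on matrices) there is `g : M₂(ℂ) → (Circle →ᵇ E)` smooth, compactly
supported, `g X z = f ((z : ℂ) • X)`. [cite: HormanderALPDO1, §1.1 Thms. 1.1.6, 1.1.8 (pp. 8–11)] -/
theorem exists_contDiff_curry_circle_smul {E : Type*} [NormedAddCommGroup E] [NormedSpace ℝ E] {f : Matrix (Fin 2) (Fin 2) ℂ → E}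
    (hf : ContDiff ℝ ∞ f) (hfc : HasCompactSupport f) :
    ∃ g : Matrix (Fin 2) (Fin 2) ℂ → BoundedContinuousFunction Circle E,
      ContDiff ℝ ∞ g ∧ HasCompactSupport g ∧ ∀ (X : Matrix (Fin 2) (Fin 2) ℂ) (z : Circle), g X z = f ((z : ℂ) • X) := by
  obtain ⟨g, hg, hgc, hgf, -⟩ := exists_contDiff_curry_circle_smul_of_normedSpace hf hfc
  exact ⟨g, hg, hgc, hgf⟩

end CircleAction

end Literature.Analysis.Calculus
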